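import Summits.Langlands.Langlands.Theses.QuarterDeficit1951
import Literature.NumberTheory.Automorphic.GL2AdelicWeightVectors
import Literature.NumberTheory.Automorphic.StrongArtinCentralCharacter
import Literature.NumberTheory.Automorphic.CarayolCompatibilityOfLocalGlobalProofs

/-!
# Sketch — crux-ideate stmt-Langlands-15898 (`QuarterDeficit1951.CorrespondentFingerprint`), ideator k = 2

First lemmas of the two idea cards (signatures only; `sorry` bodies are deliberate — NO skeleton at
this stage).  Card 1 `even-parity-pincer`: `liouville_neg_eigenvalue`, `IsOfWeightZero`,
`isOfWeightZero_of_isLAlgebraic_of_even`.  Card 2 `invert-rec-on-principal-series`: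
`recGL_unramified_at_ell`, `isSatakeParameter_of_recGL_unramified`.
-/

-- Mathlib idiom (Mathlib/Algebra/Lie/OfAssociative.lean); needed to mention Lie subalgebras of matrix algebras
attribute [local instance 100] LieRing.ofAssociativeRing

noncomputable section

open scoped MatrixGroups Matrix NumberField NNReal Polynomial Classical
open NumberField IsDedekindDomain Polynomial
open Literature.NumberTheory.Automorphic Literature.NumberTheory.GaloisRepresentations
open Literature.NumberTheory.Automorphic.GL2Real

namespace Summit.Langlands.Langlands.Cruxes.CorrespondentFingerprint.Sketch

/-! ## Card 1 — even parity pincer -/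

/-- **Liouville for negative Laplace eigenvalues** (card 1, step A3): a bounded `C²` solution of
`Δu + λu = 0` on `ℍ` with `λ < 0` vanishes.  Route: Iwaniec Thm 1.14/1.16
(`invariantOperator_eigenfunction`, in tree) with the ball kernel `𝟙_{[0,δ]}`; the ball average of
`(Im w)^s`, `s = 1/2 + √(1/4 - λ) > 1`, grows like `e^{(s-1)r}` while `vol B_r ≍ e^r` bounds the
left side by `‖u‖_∞`. [cite: Iwaniec2002, Thm 1.16] -/
theorem liouville_neg_eigenvalue (u : UpperHalfPlane → ℂ) (lam : ℝ) (hlam : lam < 0)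
    (hu : IsC2 u) (heig : ∀ z, hypLaplacian u z + (lam : ℂ) * u z = 0)
    (hbdd : ∃ C : ℝ, ∀ z, ‖u z‖ ≤ C) : u = 0 := by
  sorry

variable {hcpt : isCompact_glFiniteIntegralLevel 2 ℚ}

/-- **`π` is of weight zero** (even twin of the tree's `AutomorphicRepData.IsOfWeightOne`):
Harish-Chandra parameter `{0, 0}` and `-1_∞ = k_π ∈ SO(2)` acts by `+1` on `W / W'` — the two
invariants singling out `π(1,1)`, `π(sgn,sgn)` (weight `0`, `λ = 1/4`) among the irreducible
`(𝔤𝔩₂, O(2))`-modules of parameter `{0,0}` (Jacquet–Langlands 1970, Thm. 5.11).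
[cite: JacquetLanglands1970, Thm. 5.11] [cite: Gelbart1997, Remark 2.5.2] -/
def IsOfWeightZero (π : AutomorphicRepData (AutomorphyDatum.gl 2 ℚ hcpt)) : Prop :=
  π.HasArchParameter (fun _ ↦ {0, 0}) ∧
    ∀ φ ∈ π.W,
      rightTranslation (AdelicGroupData.gl 2 ℚ)
          ((AutomorphyDatum.gl 2 ℚ hcpt).ofArch ⟨-1, trivial⟩) φ - φ ∈ π.W'

/-- **The pincer** (card 1, first lemma): for a CUSPIDAL clean (`W' = ⊥`) datum `π` on
`GL₂(𝔸_ℚ)` that is L-algebraic, on which the split centre `A_G = ℝ_{>0}` acts trivially and the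
archimedean `-1` acts by `+1` (both follow from "central character = ψ_{χ₀}, χ₀ of ODD order"),
`π` is of weight zero and has a non-zero `SO(2)`-invariant vector.  Proof line: L-algebraic ⇒
parameter `{s₁,s₂} ⊂ ℤ`; `A_G` trivial ⇒ `s₁ + s₂ = 0` (`lieDeriv_one_sub_smul_mem`, as in
`IsPiOfArtinRep.add_eq_zero_of_hasArchParameter`) ⇒ `{a,-a}`; `-1 = k_π` acts by `+1` ⇒ all
`SO(2)`-weights even; a weight vector of minimal `|m|` with `m ≠ 0` is killed by `lowerFun`
(minimality, `ε`-symmetry), so `raiseFun_lowerFun_of_isWeightVec` + the Casimir scalar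
`2a² - 1/2` force `(m-1)² = 4a²`, `m` odd — contradiction; so `m = 0` occurs, its restriction
`u(x+iy) = ψ((y x; 0 1)_∞)` is a bounded (`cuspForm_bounded_holds`) eigenfunction with
`λ = 1/4 - a²`, and `liouville_neg_eigenvalue` gives `a = 0`.  No unitarity, no Galois input.
[cite: BuzzardGeeLMS2014, §3.3] [cite: Bump1997, §2.5] -/
theorem isOfWeightZero_of_isLAlgebraic_of_even (π : AutomorphicRepData (AutomorphyDatum.gl 2 ℚ hcpt))
    (hcusp : π.W ≤ cuspFormsGL 2 ℚ hcpt) (hbot : π.W' = ⊥) (hL : π.IsLAlgebraic)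
    (hpos : ∀ (t : ℝ≥0ˣ), ∀ φ ∈ π.W,
      rightTranslation (AdelicGroupData.gl 2 ℚ)
        (show (AdelicGroupData.gl 2 ℚ).Adelic from posRealScalar 2 ℚ t) φ = φ)
    (heven : ∀ φ ∈ π.W, ∀ g, φ (g * Rat.iotaA (rotK Real.pi)) = φ g) :
    IsOfWeightZero π ∧ ∃ ψ ∈ π.W, ψ ≠ 0 ∧ IsWeightVec Rat.iotaA 0 ψ := by
  sorry

/-! ## Card 2 — invert `rec` only on principal series -/

/-- **`v = ℓ` is spherical for free** (card 2, first lemma (a)): local–global compatibility at a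
place `v ∣ ℓ` at which `ρ` is unramified hands `rec(π_v)` an UNRAMIFIED Weil–Deligne class with
`N = 0` — from the STRUCTURE FIELD `PstWeilDeligneData.wd_of_isLocallyUnramified` of every `p`-adic
Hodge datum (so for the pinned `RD.pst` WITHOUT `FontaineDatumExists`), transported along `ι`
(`IsTransportAlong`) and through Frobenius-semisimplification.  The Frobenius EIGENVALUES at `ℓ` are
NOT claimed (they need clause (F8)); the crux never uses them (`P₀ ⊆ {2,…,13}`, `ℓ ≥ 17`).
[cite: FontaineAsterisque223VIII, §1.3] [cite: TateCorvallis1979, (4.1.3)] -/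
theorem recGL_unramified_at_ell {ℓ : ℕ} [Fact ℓ.Prime] (RD : Summit.Langlands.ReciprocityData ℚ)
    (ι : PadicAlgCl ℓ ≃+* ℂ) (π : AutomorphicRepData (AutomorphyDatum.gl 2 ℚ hcpt))
    (ρ : FramedGaloisRep ℚ (PadicAlgCl ℓ) 2) (v : HeightOneSpectrum (𝓞 ℚ))
    (hv : ((ℓ : ℕ) : 𝓞 ℚ) ∈ v.asIdeal) (hur : ρ.IsUnramifiedAt v)
    (h : Summit.Langlands.LocalGlobalCompatibleAt RD ι π ρ v) :
    ∃ (πv : SmoothIrrep (GL (Fin 2) (v.adicCompletion ℚ)))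
      (A : WeilDeligneRep (v.adicCompletion ℚ) ℂ (Fin 2 → ℂ)) (hA : A.IsFrobSemisimple),
      π.HasLocalComponentAt v πv.ρ ∧
        (RD.llc v).recGL 2 (IrrClass.mk πv) =
          Quotient.mk (frobSemisimpleWDSetoid (v.adicCompletion ℚ) 2) ⟨A, hA⟩ ∧
        A.N = 0 ∧ WeilGroup.IsUnramifiedRep A.ρ := by
  sorry

/-- **Unramified inversion of the typed `rec`** (card 2, first lemma (b)): if `rec(π_v)` is the
class of an unramified `N = 0` Weil–Deligne representation whose geometric-Frobenius eigenvalues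
`x₀, x₁` are not in ratio `q^{±1}`, then `π_v` is the spherical principal series with Satake
parameter `{x₀, x₁}`.  Proof line: construct the unramified principal series `P(x)` (irreducible,
generic: `parabolicIndGL`, `exists_mem_fixedPoints_glInt_parabolicIndGL_fin_two`, Jacquet module),
compute `rec(P(x))` by the tree's FORWARD lemma
`WeilDeligneRep.unramified_of_hasFrobSemisimpleClass_recGL_of_isSatakeParameter` (clause
`lFactor_pairs` at `m = 1` + the spherical zeta integral), conclude by INJECTIVITY of `recGL 2`
(`LocalLanglandsDatum.recGL_bijective`).  No classification of `Irr(GL₂(F))`, no `ε`-factors.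
[cite: JacquetLanglands1970, Prop. 3.5] [cite: HarrisTaylorAMS2001, Thm. A (i) and (v)] -/
theorem isSatakeParameter_of_recGL_unramified {F : Type} [Field F] [ValuativeRel F]
    [TopologicalSpace F] [IsNonarchimedeanLocalField F] (L : LocalLanglandsDatum F)
    (πv : SmoothIrrep (GL (Fin 2) F)) (A : WeilDeligneRep F ℂ (Fin 2 → ℂ)) (hA : A.IsFrobSemisimple)
    (hrec : L.recGL 2 (IrrClass.mk πv) = Quotient.mk (frobSemisimpleWDSetoid F 2) ⟨A, hA⟩)
    (hN : A.N = 0) (hur : WeilGroup.IsUnramifiedRep A.ρ) {ϖ : Fˣ}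
    (hϖ : IsUniformizingElement (ϖ : F)) (x : Fin 2 → ℂ)
    (hx : ∀ Φ : WeilGroup F, WeilGroup.deg Φ = -1 →
      (LinearMap.toMatrix' (A.ρ Φ)).charpoly = ∏ i, (X - C (x i)))
    (hq : x 0 ≠ (IsNonarchimedeanLocalField.residueFieldCard F : ℂ) * x 1 ∧
      x 1 ≠ (IsNonarchimedeanLocalField.residueFieldCard F : ℂ) * x 0) :
    IsSatakeParameter πv.ρ ϖ ((Finset.univ : Finset (Fin 2)).val.map x) := by
  sorry

end Summit.Langlands.Langlands.Cruxes.CorrespondentFingerprint.Sketch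

end
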